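import Summits.QuantumFields.YangMills.Theorems.BalabanUVNodesN15CoefficientSpeciesTorus
import Summits.QuantumFields.YangMills.Theorems.BalabanUVNodesN15CurvedGeneratorFitsZd
import HarnessLib

/-!
# Route «BalabanUVNodes» (cluster K4 «SpineRates»), Track-A DAG node N15 = NE2, BACKGROUND LAYER — THE GENERATOR-LEVEL DATA OF THE CURVED KNIT ON KING's FINITE TORUS
# CARRIER `blockOf L M : Tor (fine L M) → Tor M` (the FINITE carrier the knit's `Fintype` sockets need): block-neighbour compatibility of `blockOf`, and the VECTOR-VALUED S0∕S2 fits,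
# sup and gradient letters of the torus block mean, from (3.35)∕(3.36)-SHAPED per-bond letters — n15-b 12d's real-scalar torus theorems transferred through the dual-norm characterisation

Cell `pub-ymgap`, seat `pub-ymgap-dag-n15-w3` (WIDTH SEAT 3∕3 on node N15, director-ym №197 ∕ HUMAN RULING D-0149; plan `W-SEAT-START-LIST.md` §n15 item 3 — ninth piece).
`bears_on: R4∕N15 · K3⁷ SpineGivenEndpointR13SepCoPH (stmt-QuantumFields-20544)`.  Filed `--kind proof --supports stmt-QuantumFields-20544 --as helper` — COUNT-NEUTRAL.  Imports BY
NAME dag-n15-b 12d `…N15CoefficientSpeciesTorus` (`qT`, `qT_surjective`, `qT_sub_unit`, `blockOf_qT`, `blockMeanT`, `fit_blockMeanT`, `fit_bdiffN_blockMeanT`, `abs_blockMeanT_le`,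
`abs_fdiffN_blockMeanT_le`; [Lit] King `Tor`, `fine`, `site`, `blockOf`, `blockSum`, n15-a `unitVec`) and this seat's file 8 `…N15CurvedGeneratorFitsZd` (`blockMap_sub_single_compat`);
nothing in the tree is modified.

WHY.  File 7's knit `hasMaj_idef_curvDressed_exp(_of_skew)` lives on FINITE carriers (`Fintype X`, `Fintype X′`, steps `τ_μ : X ≃ X`); the lineage's finite concrete pairing is King's
torus carrier (dag-n15-a `kingLine`, dag-n15-b 12d): fine torus `Tor (fine L M)` (periods `L·M_μ`), coarse torus `Tor M`, block map `blockOf L M`, unit translations `· + unitVec`,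
`Lη′ = η`.  File 8 proved the vector-valued species fits on `ℤ^d`; THIS FILE states them ON THE TORUS, where the knit can be instantiated: every theorem is 12d's real-scalar
torus theorem applied to the scalarisations `φ ∘ a′` (`φ : V →L[ℝ] ℝ`) and reassembled by `NormedSpace.norm_le_dual_bound` ([Balaban1985BackgroundPropagators] (3.35)–(3.36) p. 396 =
SHAPES of the per-bond letters):

* §1 def `blockMeanTV` (the `V`-valued King block mean `L^{−d} Σ_{y′ ∈ block b} a′(y′)`), `apply_blockMeanTV` (scalarisation), ★ `blockOf_sub_unitVec_compat` + `blockOf_compat_addRight`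
  (`blockOf(y′ − e_μ) ∈ {blockOf y′, blockOf y′ − e_μ}` — file 7's `hcompat` on the torus, pulled back from file 8's `ℤ^d` lemma along `qT`);
* §2 ★★ `fit_blockMeanTV` (S0: `‖a′(y′) − blockMeanTV a′(blockOf y′)‖ ≤ d(L−1)·θ₁(blockOf y′)` from the in-block bond letter), `norm_blockMeanTV_le` (sup letter);
* §3 ★★ `fit_bdiffTV_blockMeanTV` (S2 in the knit's backward orientation: `‖η′⁻¹(a′(y′) − a′(y′ − e_μ)) − η⁻¹(ā(b) − ā(b − e_μ))‖ ≤ (d+1)(L−1)·θ₂(b − e_μ)`, `b = blockOf y′`, from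
  the (3.36)-shaped slab letter), `norm_fdiffTV_blockMeanTV_le` (the coarse gradient letter of the block mean IS the fine one).

HONEST FRAMING ∕ LIMITS.  Transfer plumbing (12d + linear algebra); LINEARISED transport (block mean of the generator; Bałaban's (C3) n-fold average = NE3's currency, untouched);
flat differences; crude constants; nothing of [B9] asserted.  NE2⁺ NOT PRINTED, NOT proved; N15 NOT discharged; counts of record UNMOVED (typed 28∕28 · discharged 5∕27); finite tori
at fixed ε — NOT infinite volume, NOT OS on ℝ⁴, NOT a mass gap, NOT Clay; R4 closes the conditional finite-𝕋⁴ rung `BalabanLadder.UV` only.  Restate-immune (no Theses import).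
-/

set_option autoImplicit false

noncomputable section
open scoped BigOperators
open Finset

namespace Summit.QuantumFields.YangMills.BalabanUVNodes.N15.CurvedSpecies

open Literature.MathematicalPhysics.QuantumFieldTheory.Balaban1983to89
open Literature.MathematicalPhysics.QuantumFieldTheory.Balaban1983to89.B5Prop11Plancherel (Tor fine)
open Literature.MathematicalPhysics.QuantumFieldTheory.King1986.Torus (site blockOf blockOf_site blockSum)
open Literature.MathematicalPhysics.QuantumLattice (blockMap)
open Literature.Probability.LatticeModels (Site)
open Summit.QuantumFields.YangMills.BalabanUVNodes.N15.DerivDefect (fdiffN bdiffN fdiffN_apply bdiffN_apply)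
open Summit.QuantumFields.YangMills.BalabanUVNodes.N15.KingTorusLine (unitVec)
open Summit.QuantumFields.YangMills.BalabanUVNodes.N15.CoefficientSpecies (qT qT_surjective qT_sub_unit blockOf_qT blockMeanT fit_blockMeanT fit_bdiffN_blockMeanT
  abs_blockMeanT_le abs_fdiffN_blockMeanT_le)

variable {d : ℕ} (L : ℕ) [NeZero L] (M : Fin d → ℕ) [hM : ∀ μ, NeZero (M μ)]
variable {V : Type} [NormedAddCommGroup V] [NormedSpace ℝ V]

/-! ## §1 The vector-valued King block mean; block-neighbour compatibility on the torus -/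

section BlockMean

/-- THE `V`-VALUED KING BLOCK MEAN `(Qa′)(b) = L^{−d} Σ_{j ∈ [0,L)^d} a′(site b j)` (12d `blockMeanT` for vector values). [folklore] -/
def blockMeanTV (a' : Tor (fine L M) → V) (b : Tor M) : V := ((L : ℝ) ^ d)⁻¹ • ∑ j : Fin d → Fin L, a' (site L M b j)

omit [NeZero L] hM in
/-- SCALARISATION: `φ(blockMeanTV a′ b) = blockMeanT (φ ∘ a′) b`. [folklore] -/
theorem apply_blockMeanTV (φ : V →L[ℝ] ℝ) (a' : Tor (fine L M) → V) (b : Tor M) : φ (blockMeanTV L M a' b) = blockMeanT L M (fun y => φ (a' y)) b := by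
  rw [blockMeanTV, map_smul, map_sum, blockMeanT, blockSum, smul_eq_mul, div_eq_inv_mul]

/-- ★ ONE FINE STEP BACK STAYS IN THE BLOCK OR ENTERS THE PRECEDING BLOCK, on the torus: `blockOf(y′ − e_μ) = blockOf y′` or `= blockOf y′ − e_μ` — file 8's `ℤ^d` lemma
pulled back along the covering map `qT`. [folklore] -/
theorem blockOf_sub_unitVec_compat (y' : Tor (fine L M)) (μ : Fin d) :
    blockOf L M (y' - unitVec (fine L M) μ) = blockOf L M y' ∨ blockOf L M (y' - unitVec (fine L M) μ) = blockOf L M y' - unitVec M μ := by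
  have hL : 0 < L := Nat.pos_of_ne_zero (NeZero.ne L)
  obtain ⟨x', rfl⟩ := qT_surjective (fine L M) y'
  rw [← qT_sub_unit, blockOf_qT, blockOf_qT]
  rcases blockMap_sub_single_compat hL x' μ with h | h
  · left; rw [h]
  · right; rw [h, qT_sub_unit]

/-- The same in file 7's `hcompat` shape for the steps `Equiv.addRight (unitVec …)` on both tori. [folklore] -/
theorem blockOf_compat_addRight (μ : Fin d) (y' : Tor (fine L M)) :
    blockOf L M ((Equiv.addRight (unitVec (fine L M) μ)).symm y') = blockOf L M y' ∨
      blockOf L M ((Equiv.addRight (unitVec (fine L M) μ)).symm y') = (Equiv.addRight (unitVec M μ)).symm (blockOf L M y') := by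
  simp only [Equiv.addRight_symm, Equiv.coe_addRight, ← sub_eq_add_neg]
  exact blockOf_sub_unitVec_compat L M y' μ

end BlockMean

/-! ## §2 Species S0 and the sup letter on the torus, vector-valued -/

section Species0

/-- ★★ **SPECIES S0 ON THE TORUS, VECTOR-VALUED** (file 7's plain fit `o` on King's carrier): from the in-block bond letter `‖a′(y′ + e_ν) − a′(y′)‖ ≤ θ₁(blockOf y′)` (`θ₁ ≥ 0`),
`‖a′(y′) − blockMeanTV a′(blockOf y′)‖ ≤ d(L−1)·θ₁(blockOf y′)` (12d `fit_blockMeanT` scalarised). [cite: Balaban1985BackgroundPropagators, (3.35) p.396 (shape)] -/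
theorem fit_blockMeanTV {a' : Tor (fine L M) → V} {θ₁ : Tor M → ℝ} (hθ : ∀ b, 0 ≤ θ₁ b)
    (h : ∀ (y' : Tor (fine L M)) (ν : Fin d), blockOf L M (y' + unitVec (fine L M) ν) = blockOf L M y' → ‖a' (y' + unitVec (fine L M) ν) - a' y'‖ ≤ θ₁ (blockOf L M y'))
    (y' : Tor (fine L M)) :
    ‖a' y' - blockMeanTV L M a' (blockOf L M y')‖ ≤ (d : ℝ) * ((L : ℝ) - 1) * θ₁ (blockOf L M y') := by
  have hL1 : (0 : ℝ) ≤ (L : ℝ) - 1 := by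
    have h1 : (1 : ℝ) ≤ L := (by exact_mod_cast Nat.pos_of_ne_zero (NeZero.ne L)); linarith
  have hC : 0 ≤ (d : ℝ) * ((L : ℝ) - 1) * θ₁ (blockOf L M y') := mul_nonneg (mul_nonneg (Nat.cast_nonneg _) hL1) (hθ _)
  refine NormedSpace.norm_le_dual_bound ℝ _ hC fun φ => ?_
  have hs := fit_blockMeanT L M (a' := fun y => φ (a' y)) (θ₁ := fun b => ‖φ‖ * θ₁ b) (fun b => mul_nonneg (norm_nonneg _) (hθ b))
    (fun y ν hy => by rw [← map_sub, ← Real.norm_eq_abs]; exact (φ.le_opNorm _).trans (mul_le_mul_of_nonneg_left (h y ν hy) (norm_nonneg _))) y'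
  rw [← apply_blockMeanTV, ← map_sub] at hs
  calc ‖φ (a' y' - blockMeanTV L M a' (blockOf L M y'))‖ = |φ (a' y' - blockMeanTV L M a' (blockOf L M y'))| := Real.norm_eq_abs _
    _ ≤ (d : ℝ) * ((L : ℝ) - 1) * (‖φ‖ * θ₁ (blockOf L M y')) := hs
    _ = (d : ℝ) * ((L : ℝ) - 1) * θ₁ (blockOf L M y') * ‖φ‖ := by ring

/-- SUP LETTER ON THE TORUS, VECTOR-VALUED ((R3) linearised): `‖a′‖ ≤ r` on the block ⟹ `‖blockMeanTV a′(b)‖ ≤ r` (`0 ≤ r`). [folklore] -/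
theorem norm_blockMeanTV_le {a' : Tor (fine L M) → V} {b : Tor M} {r : ℝ} (hr : 0 ≤ r) (h : ∀ j : Fin d → Fin L, ‖a' (site L M b j)‖ ≤ r) :
    ‖blockMeanTV L M a' b‖ ≤ r := by
  refine NormedSpace.norm_le_dual_bound ℝ _ hr fun φ => ?_
  have hs := abs_blockMeanT_le L M (a' := fun y => φ (a' y)) (b := b) (C := ‖φ‖ * r) fun j => by
    rw [← Real.norm_eq_abs]; exact (φ.le_opNorm _).trans (mul_le_mul_of_nonneg_left (h j) (norm_nonneg _))
  rw [← apply_blockMeanTV] at hs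
  rw [Real.norm_eq_abs, mul_comm]; exact hs

end Species0

/-! ## §3 Species S2 and the gradient letter on the torus, vector-valued -/

section Species2

omit [NeZero L] hM in
/-- Scalarised forward quotients on the torus. [folklore] -/
theorem fdiffN_unitVec_comp_apply (N : Fin d → ℕ) (φ : V →L[ℝ] ℝ) (η : ℝ) (μ : Fin d) (a : Tor N → V) (y : Tor N) :
    fdiffN η (fun w => w + unitVec N μ) (fun w => φ (a w)) y = φ (η⁻¹ • (a (y + unitVec N μ) - a y)) := by
  rw [fdiffN_apply, map_smul, map_sub, smul_eq_mul]

omit [NeZero L] hM in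
/-- Scalarised adjoint quotients on the torus: `η⁻¹(g(y − e_μ) − g(y))`. [folklore] -/
theorem bdiffN_unitVec_comp_apply (N : Fin d → ℕ) (φ : V →L[ℝ] ℝ) (η : ℝ) (μ : Fin d) (a : Tor N → V) (y : Tor N) :
    bdiffN η (Equiv.addRight (unitVec N μ)) (fun w => φ (a w)) y = φ (η⁻¹ • (a (y - unitVec N μ) - a y)) := by
  simp only [bdiffN_apply, Equiv.addRight_symm, Equiv.coe_addRight, ← sub_eq_add_neg, map_smul, map_sub, smul_eq_mul]

/-- ★★ **SPECIES S2 ON THE TORUS, VECTOR-VALUED, THE KNIT's BACKWARD ORIENTATION** (file 7's `o_D` on King's carrier, `Lη′ = η`): from the (3.36)-shaped vector letter on the slab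
`block(b) ∪ block(b + e_μ)` — unit differences of the fine quotient field `η′⁻¹(a′(· + e_μ) − a′(·))` are `≤ θ₂(b)` there (`θ₂ ≥ 0`) —
`‖η′⁻¹(a′(y′) − a′(y′ − e_μ)) − η⁻¹(blockMeanTV a′(b) − blockMeanTV a′(b − e_μ))‖ ≤ (d+1)(L−1)·θ₂(b − e_μ)`, `b = blockOf y′` (12d `fit_bdiffN_blockMeanT` scalarised; the adjoint
quotient is minus the backward one, norms agree). [cite: Balaban1985BackgroundPropagators, (3.36) p.396 (shape)] -/
theorem fit_bdiffTV_blockMeanTV (μ : Fin d) {η η' : ℝ} (hLη : (L : ℝ) * η' = η) {a' : Tor (fine L M) → V} {θ₂ : Tor M → ℝ} (hθ : ∀ b, 0 ≤ θ₂ b)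
    (h : ∀ (b : Tor M) (z' : Tor (fine L M)), (blockOf L M z' = b ∨ blockOf L M z' = b + unitVec M μ) → ∀ ν : Fin d,
      ‖η'⁻¹ • (a' (z' + unitVec (fine L M) ν + unitVec (fine L M) μ) - a' (z' + unitVec (fine L M) ν)) - η'⁻¹ • (a' (z' + unitVec (fine L M) μ) - a' z')‖ ≤ θ₂ b)
    (y' : Tor (fine L M)) :
    ‖η'⁻¹ • (a' y' - a' (y' - unitVec (fine L M) μ)) -
        η⁻¹ • (blockMeanTV L M a' (blockOf L M y') - blockMeanTV L M a' (blockOf L M y' - unitVec M μ))‖ ≤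
      ((d : ℝ) + 1) * ((L : ℝ) - 1) * θ₂ (blockOf L M y' - unitVec M μ) := by
  have hL1 : (0 : ℝ) ≤ (L : ℝ) - 1 := by
    have h1 : (1 : ℝ) ≤ L := (by exact_mod_cast Nat.pos_of_ne_zero (NeZero.ne L)); linarith
  have hC : 0 ≤ ((d : ℝ) + 1) * ((L : ℝ) - 1) * θ₂ (blockOf L M y' - unitVec M μ) := mul_nonneg (mul_nonneg (by positivity) hL1) (hθ _)
  have hflip : η'⁻¹ • (a' y' - a' (y' - unitVec (fine L M) μ)) - η⁻¹ • (blockMeanTV L M a' (blockOf L M y') - blockMeanTV L M a' (blockOf L M y' - unitVec M μ)) =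
      -(η'⁻¹ • (a' (y' - unitVec (fine L M) μ) - a' y') - η⁻¹ • (blockMeanTV L M a' (blockOf L M y' - unitVec M μ) - blockMeanTV L M a' (blockOf L M y'))) := by
    simp only [smul_sub]; abel
  rw [hflip, norm_neg]
  refine NormedSpace.norm_le_dual_bound ℝ _ hC fun φ => ?_
  have h' : ∀ (b : Tor M) (z' : Tor (fine L M)), (blockOf L M z' = b ∨ blockOf L M z' = b + unitVec M μ) → ∀ ν : Fin d,
      |fdiffN η' (fun y => y + unitVec (fine L M) μ) (fun w => φ (a' w)) (z' + unitVec (fine L M) ν) -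
        fdiffN η' (fun y => y + unitVec (fine L M) μ) (fun w => φ (a' w)) z'| ≤ ‖φ‖ * θ₂ b := fun b z' hz ν => by
    rw [fdiffN_unitVec_comp_apply, fdiffN_unitVec_comp_apply, ← map_sub, ← Real.norm_eq_abs]
    exact (φ.le_opNorm _).trans (mul_le_mul_of_nonneg_left (h b z' hz ν) (norm_nonneg _))
  have hs := fit_bdiffN_blockMeanT L M μ hLη (a' := fun w => φ (a' w)) (θ₂ := fun b => ‖φ‖ * θ₂ b) h' y'
  have hcoarse : bdiffN η (Equiv.addRight (unitVec M μ)) (blockMeanT L M fun w => φ (a' w)) (blockOf L M y') =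
      φ (η⁻¹ • (blockMeanTV L M a' (blockOf L M y' - unitVec M μ) - blockMeanTV L M a' (blockOf L M y'))) := by
    simp only [bdiffN_apply, Equiv.addRight_symm, Equiv.coe_addRight, ← sub_eq_add_neg, map_smul, map_sub, apply_blockMeanTV, smul_eq_mul]
  rw [bdiffN_unitVec_comp_apply, hcoarse, ← map_sub] at hs
  calc _ = |φ (η'⁻¹ • (a' (y' - unitVec (fine L M) μ) - a' y') - η⁻¹ • (blockMeanTV L M a' (blockOf L M y' - unitVec M μ) - blockMeanTV L M a' (blockOf L M y')))| :=
        Real.norm_eq_abs _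
    _ ≤ ((d : ℝ) + 1) * ((L : ℝ) - 1) * (‖φ‖ * θ₂ (blockOf L M y' - unitVec M μ)) := hs
    _ = ((d : ℝ) + 1) * ((L : ℝ) - 1) * θ₂ (blockOf L M y' - unitVec M μ) * ‖φ‖ := by ring

/-- GRADIENT LETTER OF THE TORUS BLOCK MEAN, VECTOR-VALUED ((R3) linearised, 12d `abs_fdiffN_blockMeanT_le`, `Lη′ = η`): a bound `G ≥ 0` on the fine quotients on the window
`{site b j + k e_μ : k < L}` gives the SAME bound on the coarse quotient `η⁻¹(blockMeanTV a′(b + e_μ) − blockMeanTV a′(b))`. [cite: Balaban1985BackgroundPropagators, (3.35) p.396 (shape)] -/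
theorem norm_fdiffTV_blockMeanTV_le (μ : Fin d) {η η' : ℝ} (hLη : (L : ℝ) * η' = η) {a' : Tor (fine L M) → V} {b : Tor M} {G : ℝ} (hG : 0 ≤ G)
    (h : ∀ (j : Fin d → Fin L) (k : ℕ), k < L →
      ‖η'⁻¹ • (a' (site L M b j + Pi.single μ ((k : ℤ) : ZMod (fine L M μ)) + unitVec (fine L M) μ) - a' (site L M b j + Pi.single μ ((k : ℤ) : ZMod (fine L M μ))))‖ ≤ G) :
    ‖η⁻¹ • (blockMeanTV L M a' (b + unitVec M μ) - blockMeanTV L M a' b)‖ ≤ G := by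
  refine NormedSpace.norm_le_dual_bound ℝ _ hG fun φ => ?_
  have hs := abs_fdiffN_blockMeanT_le L M μ hLη (a' := fun w => φ (a' w)) (b := b) (G := ‖φ‖ * G) fun j k hk => by
    rw [fdiffN_unitVec_comp_apply, ← Real.norm_eq_abs]; exact (φ.le_opNorm _).trans (mul_le_mul_of_nonneg_left (h j k hk) (norm_nonneg _))
  have hcoarse : fdiffN η (fun c => c + unitVec M μ) (blockMeanT L M fun w => φ (a' w)) b = φ (η⁻¹ • (blockMeanTV L M a' (b + unitVec M μ) - blockMeanTV L M a' b)) := by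
    rw [fdiffN_apply, map_smul, map_sub, apply_blockMeanTV, apply_blockMeanTV, smul_eq_mul]
  rw [hcoarse] at hs
  rw [Real.norm_eq_abs, mul_comm]; exact hs

end Species2

end Summit.QuantumFields.YangMills.BalabanUVNodes.N15.CurvedSpecies

end
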